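import Literature.Analysis.FluidPDE.CKNEpsilonRegularity
import HarnessLib

/-!
# Mass of parabolic-Morrey data in thin time slabs

Analysis/FluidPDE file in the decomposition of the named fact
`Literature.Analysis.FluidPDE.LemarieRieusset2016.prop13_4` (Lemarié-Rieusset 2016, Prop. 13.4,
p. 464), more precisely of its `σ(D)g`-part: the kernel `1_{t>0} σ(D)W_{νt}` of a Fourier
multiplier homogeneous of degree `1` jumps across `t = 0` away from the origin, so the Hölder
estimate of `∫₀ᵗ W_{ν(t-s)} * σ(D)g(s) ds` and the absolute convergence of that integral need,
besides the parabolic-Morrey bound on cylinders `∫∫_{Q_r(c)} |g| ≤ B r^d`, a bound for the mass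
of `g` in a **thin slab** `(a, a + δ²) × B(x, R)` with `R ≥ δ`, where the cylinder bound with
radius `R` (time extent `2R² ≫ δ²`) is far too generous. This file **proves** that bound by the
obvious covering: `B(x, R)` is covered by the `(2N)³` balls of radius `δ` centred at the lattice
points `x + (δ/2)ℤ³` with indices in `[-N, N)`, `N = ⌈2R/δ⌉ ≤ 3R/δ`, and each
`(a, a + δ²) × B(c, δ)` lies in the cylinder `Q_δ(a, c)`:

* `lintegral_slab_le_of_morrey` — `∫∫_{(a, a+δ²) × B(x,R)} |F| ≤ 216 (R/δ)³ B δ^d`.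

Nothing here is specific to Navier–Stokes.

## References

* P. G. Lemarié-Rieusset, *The Navier–Stokes Problem in the 21st Century*, CRC Press (2016),
  Prop. 13.4, pp. 464–465 (where the estimate is used implicitly). [LemarieRieusset2016]
-/

noncomputable section

open MeasureTheory Set Function Filter Metric
open scoped NNReal ENNReal

namespace Literature.Analysis.FluidPDE

/-- Local notation for physical space `ℝ³ = EuclideanSpace ℝ (Fin 3)`. -/
local notation "ℝ³" => EuclideanSpace ℝ (Fin 3)

/-- The lattice point `x + (δ/2) i`, `i ∈ ℤ³`. [folklore] -/
def latticePoint (x : ℝ³) (δ : ℝ) (i : Fin 3 → ℤ) : ℝ³ :=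
  x + WithLp.toLp 2 fun m => δ / 2 * (i m : ℝ)

/-- **Covering of a ball by lattice balls**: every `y ∈ B(x, R)` lies in the ball of radius `δ`
about the lattice point `x + (δ/2)⌊2(y - x)/δ⌋` (componentwise floor), whose index lies in
`[-N, N)³` as soon as `2R/δ ≤ N`. [folklore] -/
theorem exists_latticePoint_near {x y : ℝ³} {R δ : ℝ} {N : ℕ} (hδ : 0 < δ) (hy : y ∈ ball x R)
    (hN : 2 * R / δ ≤ N) :
    ∃ i : Fin 3 → ℤ, (∀ m, -(N : ℤ) ≤ i m ∧ i m < N) ∧ y ∈ ball (latticePoint x δ i) δ := by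
  have hδ2 : 0 < δ / 2 := by positivity
  set v : Fin 3 → ℝ := fun m => (y m - x m) / (δ / 2) with hv
  set i : Fin 3 → ℤ := fun m => ⌊v m⌋ with hi
  have hyx : ‖y - x‖ < R := by rwa [mem_ball, dist_eq_norm] at hy
  have hcomp : ∀ m, |y m - x m| < R := fun m =>
    lt_of_le_of_lt (by simpa using PiLp.norm_apply_le (y - x) m) hyx
  refine ⟨i, fun m => ?_, ?_⟩
  · have h1 : |v m| < 2 * R / δ := by
      rw [hv]
      simp only
      rw [abs_div, abs_of_pos hδ2, div_lt_div_iff₀ hδ2 hδ]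
      nlinarith [hcomp m]
    have h2 : |v m| < N := h1.trans_le hN
    rw [abs_lt] at h2
    constructor
    · rw [hi]
      simp only
      rw [Int.le_floor]
      push_cast
      linarith [h2.1]
    · rw [hi]
      simp only
      rw [Int.floor_lt]
      push_cast
      linarith [h2.2]
  · rw [mem_ball, dist_eq_norm]
    have hcoord : ∀ m, |(y - latticePoint x δ i) m| ≤ δ / 2 := by
      intro m
      have e : (y - latticePoint x δ i) m = δ / 2 * (v m - ⌊v m⌋) := by
        simp only [latticePoint, hv, hi, PiLp.sub_apply, PiLp.add_apply]
        field_simp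
        ring
      rw [e, abs_mul, abs_of_pos hδ2]
      have h0 : 0 ≤ v m - ⌊v m⌋ := Int.fract_nonneg (v m)
      have h1 : v m - ⌊v m⌋ < 1 := Int.fract_lt_one (v m)
      rw [abs_of_nonneg h0]
      nlinarith
    have hsq : ‖y - latticePoint x δ i‖ ^ 2 < δ ^ 2 := by
      rw [EuclideanSpace.real_norm_sq_eq]
      calc ∑ m, (y - latticePoint x δ i) m ^ 2 ≤ ∑ _m : Fin 3, (δ / 2) ^ 2 :=
            Finset.sum_le_sum fun m _ => by
              rw [← sq_abs]
              exact pow_le_pow_left₀ (abs_nonneg _) (hcoord m) 2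
        _ = 3 * (δ / 2) ^ 2 := by simp
        _ < δ ^ 2 := by nlinarith
    exact lt_of_pow_lt_pow_left₀ 2 hδ.le hsq

/-- **Thin slabs over lattice balls lie in parabolic cylinders**:
`(a, a + δ²) × B(c, δ) ⊆ Q_δ(a, c) = (a - δ², a + δ²) × B(c, δ)`. [folklore] -/
theorem slab_ball_subset_cylinder (a δ : ℝ) (c : ℝ³) :
    Ioo a (a + δ ^ 2) ×ˢ ball c δ ⊆ FluidPDE.parabolicCylinderCentered δ ((a, c) : ℝ × ℝ³) := by
  rintro ⟨s, y⟩ ⟨hs, hy⟩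
  rw [FluidPDE.mem_parabolicCylinderCentered]
  rw [mem_Ioo] at hs
  exact ⟨⟨by nlinarith [sq_nonneg δ], hs.2⟩, hy⟩

/-- **Mass of Morrey data in a thin slab**: if `∫∫_{Q_r(c)} |F| ≤ B r^d` for all centred
parabolic cylinders, then for `0 < δ ≤ R`,
`∫∫_{(a, a+δ²) × B(x, R)} |F| ≤ 216 (R/δ)³ B δ^d` (cover `B(x, R)` by the `(2N)³ ≤ (6R/δ)³`
lattice balls of radius `δ`, `N = ⌈2R/δ⌉`, and apply the Morrey bound on each cylinder
`Q_δ(a, c)`). [folklore] -/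
theorem lintegral_slab_le_of_morrey {E' : Type*} [NormedAddCommGroup E'] {F : ℝ × ℝ³ → E'}
    {B d : ℝ} (hB : 0 ≤ B)
    (hMor : ∀ (c : ℝ × ℝ³) (r : ℝ), 0 < r →
      ∫⁻ w in FluidPDE.parabolicCylinderCentered r c, ‖F w‖ₑ ≤ ENNReal.ofReal (B * r ^ d))
    {δ R : ℝ} (hδ : 0 < δ) (hδR : δ ≤ R) (a : ℝ) (x : ℝ³) :
    ∫⁻ w in Ioo a (a + δ ^ 2) ×ˢ ball x R, ‖F w‖ₑ ≤
      ENNReal.ofReal (216 * (R / δ) ^ 3 * B * δ ^ d) := by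
  have hR : 0 < R := hδ.trans_le hδR
  -- the number of lattice points per direction
  set N : ℕ := ⌈2 * R / δ⌉₊ with hN
  have hN1 : 2 * R / δ ≤ N := Nat.le_ceil _
  have hN2 : (N : ℝ) ≤ 3 * R / δ := by
    have h1 : (N : ℝ) < 2 * R / δ + 1 := Nat.ceil_lt_add_one (by positivity)
    have h2 : 1 ≤ R / δ := by rw [le_div_iff₀ hδ]; linarith
    have h3 : 2 * R / δ + 1 ≤ 3 * R / δ := by
      rw [div_add_one hδ.ne', div_le_div_iff_of_pos_right hδ]
      linarith
    linarith
  -- the index set and the covering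
  set I : Finset (Fin 3 → ℤ) := Fintype.piFinset fun _ : Fin 3 => Finset.Ico (-(N : ℤ)) N with hI
  have hcardI : I.card = (2 * N) ^ 3 := by
    rw [hI, Fintype.card_piFinset_const, Int.card_Ico]
    congr 1
    omega
  have hcover : Ioo a (a + δ ^ 2) ×ˢ ball x R ⊆
      ⋃ i : I, FluidPDE.parabolicCylinderCentered δ ((a, latticePoint x δ i.1) : ℝ × ℝ³) := by
    rintro ⟨s, y⟩ ⟨hs, hy⟩
    obtain ⟨i, hiN, hyi⟩ := exists_latticePoint_near hδ hy hN1
    have hiI : i ∈ I := by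
      rw [hI, Fintype.mem_piFinset]
      intro m
      rw [Finset.mem_Ico]
      exact hiN m
    rw [mem_iUnion]
    exact ⟨⟨i, hiI⟩, slab_ball_subset_cylinder a δ _ ⟨hs, hyi⟩⟩
  -- integrate
  calc ∫⁻ w in Ioo a (a + δ ^ 2) ×ˢ ball x R, ‖F w‖ₑ
      ≤ ∫⁻ w in ⋃ i : I, FluidPDE.parabolicCylinderCentered δ ((a, latticePoint x δ i.1) : ℝ × ℝ³),
          ‖F w‖ₑ := lintegral_mono_set hcover
    _ ≤ ∑' i : I, ∫⁻ w in FluidPDE.parabolicCylinderCentered δ ((a, latticePoint x δ i.1) : ℝ × ℝ³),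
          ‖F w‖ₑ := lintegral_iUnion_le _ _
    _ = ∑ i : I, ∫⁻ w in FluidPDE.parabolicCylinderCentered δ ((a, latticePoint x δ i.1) : ℝ × ℝ³),
          ‖F w‖ₑ := tsum_fintype _
    _ ≤ ∑ _i : I, ENNReal.ofReal (B * δ ^ d) := Finset.sum_le_sum fun i _ => hMor _ δ hδ
    _ = (I.card : ℝ≥0∞) * ENNReal.ofReal (B * δ ^ d) := by
        rw [Finset.sum_const, nsmul_eq_mul, Finset.card_univ, Fintype.card_coe]
    _ = ENNReal.ofReal ((2 * (N : ℝ)) ^ 3 * (B * δ ^ d)) := by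
        rw [ENNReal.ofReal_mul (p := (2 * (N : ℝ)) ^ 3) (by positivity), hcardI,
          ← ENNReal.ofReal_natCast]
        push_cast
        rfl
    _ ≤ ENNReal.ofReal (216 * (R / δ) ^ 3 * B * δ ^ d) := by
        apply ENNReal.ofReal_le_ofReal
        have hBδ : 0 ≤ B * δ ^ d := by positivity
        have h2N : (2 * (N : ℝ)) ^ 3 ≤ 216 * (R / δ) ^ 3 := by
          have : 2 * (N : ℝ) ≤ 6 * (R / δ) := by
            rw [mul_div_assoc] at hN2
            linarith
          calc (2 * (N : ℝ)) ^ 3 ≤ (6 * (R / δ)) ^ 3 := pow_le_pow_left₀ (by positivity) this 3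
            _ = 216 * (R / δ) ^ 3 := by ring
        calc (2 * (N : ℝ)) ^ 3 * (B * δ ^ d)
            ≤ 216 * (R / δ) ^ 3 * (B * δ ^ d) := mul_le_mul_of_nonneg_right h2N hBδ
          _ = 216 * (R / δ) ^ 3 * B * δ ^ d := by ring

end Literature.Analysis.FluidPDE
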